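import Summits.Ventures.Crystal3D.Theorems.StickyWulffConstantPolycrystalWulffBoundBasalLamellarChimera

/-!
# `PolycrystalWulffBound`, rung `rung_verticalLamellar` — step 1: the CHIMERA lower bound for
# co-axial textures cut by parallel planes CONTAINING the axis (line `PolyDensity`,
# crux `stmt-Ventures-19482`)

Route `StickyWulffConstant` of the venture `Summits/Ventures/Crystal3D`, second prover lane (poly-p2,
gen 8).  `rung_basalLamellar` (poly-p2 g3) bounds the FREE energy of a polyhedral set cut by planes
`⊥ m` into lamellae with pairwise co-axial frames (axis `m`); its engine is the SL line's chimera
Brunn–Minkowski inequality `Chimera.chimera3_brunnMinkowski` — a height-dependent summand whose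
horizontal sections dominate those of a reference body — with HEIGHT `= ⟪x, m⟫`.  This file runs the
same engine with HEIGHT `= ⟪x, n⟫` for a unit vector `n ⊥ m`, i.e. for lamellae cut by parallel planes
that CONTAIN the twin axis (the incoherent Σ3 `{112}` and `{110}` walls, and every other wall plane
through `[111]`):
* `reflection_orthogonal_unit_apply`, `inner_reflection_orthogonal_unit`,
  `map_basalMirror_eq_reflection_map` — the mirror `R_m` across `(ℝ∙m)ᗮ` in formulas;
* `cruxWulffBody_eq_or_eq_reflection_image` — the PAIR clause `Ax m A B` of the crux pins the two
  Wulff bodies to each other: `W(B) = W(A)` or `W(B) = R_m '' W(A)` (via the wall lane's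
  `linear_image_eq_frame_of_subset`);
* `vertical_chimera_lower` — if a measurable `C` contains `x + r·w` for all `x ∈ G_f`, `w ∈ W(A_f)`,
  then `|⋃ G_f|^{1/3} + r·32^{1/3} ≤ |C|^{1/3}`: all bodies are `B₀` or `R_m '' B₀`, `R_m` fixes `n`,
  so in coordinates with vertical axis `n` the bodies are isometric images of one another FIXING the
  vertical axis and their horizontal sections have equal areas (`volume_slice3_image_eq`).
WHAT THIS IS NOT: the rung (the matching Minkowski-content upper bound and the cube expansion are in
`…RungVerticalLamellar`); nothing on perimeters; inclined cutting planes (`0 < |⟪n, m⟫| < 1`) are NOT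
covered (there the two section profiles differ and a wall charge is needed); the crux is not claimed.
-/

noncomputable section

open scoped BigOperators InnerProductSpace ENNReal Pointwise
open MeasureTheory Set

namespace Summit.Ventures.Crystal3D.Theorems

open Summit.Ventures.Crystal3D.Cruxes.TextureLiminf.TexShadow (E3)
open Literature.MathematicalPhysics.StatisticalMechanics (fccStacking barlowStacking IsHaggSeq)

/-! ### The mirror across the plane orthogonal to a unit vector -/

/-- The mirror across `(ℝ∙m)ᗮ` for a unit vector `m`: `R_m v = v − 2⟪m, v⟫ m`. -/
theorem reflection_orthogonal_unit_apply {m : E3} (hm : ‖m‖ = 1) (v : E3) :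
    (ℝ ∙ m)ᗮ.reflection v = v - (2 * ⟪m, v⟫_ℝ) • m := by
  rw [Submodule.reflection_orthogonal_apply, Submodule.reflection_singleton_apply, hm]
  simp only [RCLike.ofReal_real_eq_id, id_eq, one_pow, div_one, neg_sub]
  rw [two_smul, mul_smul, two_smul]

/-- The mirror across `(ℝ∙m)ᗮ` preserves the coordinate along every `n ⊥ m`. -/
theorem inner_reflection_orthogonal_unit {m n : E3} (hm : ‖m‖ = 1) (hmn : ⟪m, n⟫_ℝ = 0) (y : E3) :
    ⟪(ℝ ∙ m)ᗮ.reflection y, n⟫_ℝ = ⟪y, n⟫_ℝ := by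
  rw [reflection_orthogonal_unit_apply hm, inner_sub_left, real_inner_smul_left, hmn, mul_zero, sub_zero]

/-- The mirror across `(ℝ∙m)ᗮ` fixes every `n ⊥ m`. -/
theorem reflection_orthogonal_unit_of_inner_eq_zero {m n : E3} (hm : ‖m‖ = 1) (hmn : ⟪m, n⟫_ℝ = 0) :
    (ℝ ∙ m)ᗮ.reflection n = n := by
  rw [reflection_orthogonal_unit_apply hm, hmn, mul_zero, zero_smul, sub_zero]

/-- Conjugating the basal mirror by a frame: if `L e₂ = m` then `L ∘ R_{e₂} = R_m ∘ L`. -/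
theorem map_basalMirror_eq_reflection_map (L : E3 ≃ₗᵢ[ℝ] E3) {m : E3}
    (hL : L (EuclideanSpace.single (2 : Fin 3) (1 : ℝ)) = m) (x : E3) :
    L ((ℝ ∙ EuclideanSpace.single (2 : Fin 3) (1 : ℝ))ᗮ.reflection x) = (ℝ ∙ m)ᗮ.reflection (L x) := by
  have he : ‖(EuclideanSpace.single (2 : Fin 3) (1 : ℝ))‖ = 1 := by
    rw [PiLp.norm_single, norm_one]
  have hm : ‖m‖ = 1 := by rw [← hL, LinearIsometryEquiv.norm_map, he]
  rw [reflection_orthogonal_unit_apply he, reflection_orthogonal_unit_apply hm, map_sub, map_smul, hL]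
  congr 2
  rw [← hL, LinearIsometryEquiv.inner_map_map]

/-- Image form of the conjugation: `R_m '' (L '' S) = L '' (R_{e₂} '' S)` when `L e₂ = m`. -/
theorem reflection_image_image_eq (L : E3 ≃ₗᵢ[ℝ] E3) {m : E3}
    (hL : L (EuclideanSpace.single (2 : Fin 3) (1 : ℝ)) = m) (S : Set E3) :
    (ℝ ∙ m)ᗮ.reflection '' (L '' S) =
      L '' ((ℝ ∙ EuclideanSpace.single (2 : Fin 3) (1 : ℝ))ᗮ.reflection '' S) := by
  ext y
  simp only [mem_image]
  constructor
  · rintro ⟨_, ⟨x, hx, rfl⟩, rfl⟩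
    exact ⟨_, ⟨x, hx, rfl⟩, map_basalMirror_eq_reflection_map L hL x⟩
  · rintro ⟨_, ⟨x, hx, rfl⟩, rfl⟩
    exact ⟨L x, ⟨x, hx, rfl⟩, (map_basalMirror_eq_reflection_map L hL x).symm⟩

/-! ### The pair clause of the crux: bodies are equal or mirror images -/

/-- **The pair clause `Ax m A B` pins the two Wulff bodies to each other up to the mirror `R_m`.**
If `A '' Λ₀ ⊆ L '' B(σ) + s₁` and `B '' Λ₀ ⊆ L '' B(σ') + s₂` for Hägg words `σ, σ'` and ONE linear
isometry `L` with `L e₂ = m`, then `W(B) = W(A)` or `W(B) = R_m '' W(A)`. -/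
theorem cruxWulffBody_eq_or_eq_reflection_image {m : E3} {A B : E3 ≃ₗᵢ[ℝ] E3}
    (h : ∃ (L : E3 ≃ₗᵢ[ℝ] E3) (s₁ s₂ : E3) (σ σ' : ℤ → ℤ), IsHaggSeq σ ∧ IsHaggSeq σ' ∧
      L (EuclideanSpace.single (2 : Fin 3) (1 : ℝ)) = m ∧
      A '' fccStacking 1 (Real.sqrt (2 / 3)) ⊆
        (fun q => L q + s₁) '' barlowStacking 1 (Real.sqrt (2 / 3)) σ ∧
      B '' fccStacking 1 (Real.sqrt (2 / 3)) ⊆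
        (fun q => L q + s₂) '' barlowStacking 1 (Real.sqrt (2 / 3)) σ') :
    {y : E3 | ∀ ν : E3, ⟪y, ν⟫_ℝ ≤ Real.sqrt 2 / 4 *
        ∑ᶠ w ∈ {w | w ∈ fccStacking 1 (Real.sqrt (2 / 3)) ∧ ‖w‖ = 1}, |⟪w, B.symm ν⟫_ℝ|} =
      {y : E3 | ∀ ν : E3, ⟪y, ν⟫_ℝ ≤ Real.sqrt 2 / 4 *
        ∑ᶠ w ∈ {w | w ∈ fccStacking 1 (Real.sqrt (2 / 3)) ∧ ‖w‖ = 1}, |⟪w, A.symm ν⟫_ℝ|} ∨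
    {y : E3 | ∀ ν : E3, ⟪y, ν⟫_ℝ ≤ Real.sqrt 2 / 4 *
        ∑ᶠ w ∈ {w | w ∈ fccStacking 1 (Real.sqrt (2 / 3)) ∧ ‖w‖ = 1}, |⟪w, B.symm ν⟫_ℝ|} =
      (ℝ ∙ m)ᗮ.reflection '' {y : E3 | ∀ ν : E3, ⟪y, ν⟫_ℝ ≤ Real.sqrt 2 / 4 *
        ∑ᶠ w ∈ {w | w ∈ fccStacking 1 (Real.sqrt (2 / 3)) ∧ ‖w‖ = 1}, |⟪w, A.symm ν⟫_ℝ|} := by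
  obtain ⟨L, s₁, s₂, σ, σ', hσ, hσ', hLm, h1, h2⟩ := h
  have h1' : (fun p => A p + (0 : E3)) '' fccStacking 1 (Real.sqrt (2 / 3)) ⊆
      (fun q => L q + s₁) '' barlowStacking 1 (Real.sqrt (2 / 3)) σ := by
    simpa only [add_zero] using h1
  have h2' : (fun p => B p + (0 : E3)) '' fccStacking 1 (Real.sqrt (2 / 3)) ⊆
      (fun q => L q + s₂) '' barlowStacking 1 (Real.sqrt (2 / 3)) σ' := by
    simpa only [add_zero] using h2
  obtain ⟨-, hA⟩ := linear_image_eq_frame_of_subset A L 0 s₁ hσ h1'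
  obtain ⟨-, hB⟩ := linear_image_eq_frame_of_subset B L 0 s₂ hσ' h2'
  set R := (ℝ ∙ EuclideanSpace.single (2 : Fin 3) (1 : ℝ))ᗮ.reflection with hR
  have hfcc : barlowStacking 1 (Real.sqrt (2 / 3)) (fun _ : ℤ => (1 : ℤ)) =
      fccStacking 1 (Real.sqrt (2 / 3)) := rfl
  have key : ∀ X : E3 ≃ₗᵢ[ℝ] E3,
      X '' fccStacking 1 (Real.sqrt (2 / 3)) = L '' barlowStacking 1 (Real.sqrt (2 / 3)) (fun _ : ℤ => (-1 : ℤ)) →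
      X '' fccStacking 1 (Real.sqrt (2 / 3)) = (R.trans L) '' fccStacking 1 (Real.sqrt (2 / 3)) := by
    intro X hX
    rw [hX, twinStacking_eq_image_basalMirror, ← Set.image_comp, LinearIsometryEquiv.coe_trans]
  have hWtwin : (R.trans L) '' {y : E3 | ∀ ν : E3, ⟪y, ν⟫_ℝ ≤ Real.sqrt 2 / 4 *
        ∑ᶠ w ∈ {w | w ∈ fccStacking 1 (Real.sqrt (2 / 3)) ∧ ‖w‖ = 1},
          |⟪w, (LinearIsometryEquiv.refl ℝ E3).symm ν⟫_ℝ|} =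
      (ℝ ∙ m)ᗮ.reflection '' (L '' {y : E3 | ∀ ν : E3, ⟪y, ν⟫_ℝ ≤ Real.sqrt 2 / 4 *
        ∑ᶠ w ∈ {w | w ∈ fccStacking 1 (Real.sqrt (2 / 3)) ∧ ‖w‖ = 1},
          |⟪w, (LinearIsometryEquiv.refl ℝ E3).symm ν⟫_ℝ|}) := by
    rw [LinearIsometryEquiv.coe_trans, Set.image_comp, reflection_image_image_eq L hLm]
  rcases hσ 0 with h0 | h0 <;> rcases hσ' 0 with h0' | h0'
  · left
    rw [h0, hfcc] at hA
    rw [h0', hfcc] at hB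
    exact wulffBody_eq_of_image_eq (hB.trans hA.symm)
  · right
    rw [h0, hfcc] at hA
    rw [h0'] at hB
    rw [wulffBody_eq_of_image_eq (key B hB), wulffBody_eq_of_image_eq hA,
      cruxWulffBody_eq_image_self (R.trans L), cruxWulffBody_eq_image_self L, hWtwin]
  · right
    rw [h0] at hA
    rw [h0', hfcc] at hB
    rw [wulffBody_eq_of_image_eq hB, wulffBody_eq_of_image_eq (key A hA),
      cruxWulffBody_eq_image_self (R.trans L), cruxWulffBody_eq_image_self L, hWtwin,
      ← Set.image_comp, ← Set.image_comp]
    have hinv : (((ℝ ∙ m)ᗮ.reflection ∘ (ℝ ∙ m)ᗮ.reflection) ∘ L : E3 → E3) = L := by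
      funext x
      simp only [Function.comp_apply, Submodule.reflection_reflection]
    rw [hinv]
  · left
    rw [h0] at hA
    rw [h0'] at hB
    exact wulffBody_eq_of_image_eq ((key B hB).trans (key A hA).symm)


/-! ### The chimera lower bound for lamellae cut by planes containing the axis -/

/-- **Chimera lower bound for co-axial textures cut by parallel planes containing the axis.**  Let
`E` be measurable, `n` a unit vector with `⟪m, n⟫ = 0`, cut by the planes `⟪x, n⟫ = a_0 < … < a_k`
into lamellae `G_f = E ∩ {a_f < ⟪x,n⟫ < a_{f+1}}` carrying frames `A_f` that satisfy the crux's
co-axiality clause `Ax m (A f) (A g)` PAIRWISE, with `0 < |⋃ G_f| < ∞`.  If a measurable `C` contains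
`x + r·w` for every `x ∈ G_f`, `w ∈ W(A f)` (`r > 0`), then `|⋃ G_f|^{1/3} + r·32^{1/3} ≤ |C|^{1/3}`.
(All bodies are `B₀ = W(A f₀)` or `R_m '' B₀`; `R_m` fixes the height `⟪·, n⟫`, so in coordinates with
vertical axis `n` every body is an isometric image of `r·B₀` fixing the vertical axis and all
horizontal sections have the areas of those of `r·B₀`: `Chimera.chimera3_brunnMinkowski` applies with
equality in its domination hypothesis.) -/
theorem vertical_chimera_lower (m n : E3) (hn : ‖n‖ = 1) (hmn : ⟪m, n⟫_ℝ = 0)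
    {k : ℕ} (a : Fin (k + 1) → ℝ) (ha : StrictMono a)
    (E : Set E3) (hE : MeasurableSet E) (A : Fin k → (E3 ≃ₗᵢ[ℝ] E3))
    (hAx : ∀ f g, ∃ (L : E3 ≃ₗᵢ[ℝ] E3) (s₁ s₂ : E3) (σ σ' : ℤ → ℤ), IsHaggSeq σ ∧ IsHaggSeq σ' ∧
      L (EuclideanSpace.single (2 : Fin 3) (1 : ℝ)) = m ∧
      A f '' fccStacking 1 (Real.sqrt (2 / 3)) ⊆
        (fun q => L q + s₁) '' barlowStacking 1 (Real.sqrt (2 / 3)) σ ∧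
      A g '' fccStacking 1 (Real.sqrt (2 / 3)) ⊆
        (fun q => L q + s₂) '' barlowStacking 1 (Real.sqrt (2 / 3)) σ')
    (h0 : volume (⋃ f : Fin k, E ∩ {x : E3 | a f.castSucc < ⟪x, n⟫_ℝ ∧ ⟪x, n⟫_ℝ < a f.succ}) ≠ 0)
    (htop : volume (⋃ f : Fin k, E ∩ {x : E3 | a f.castSucc < ⟪x, n⟫_ℝ ∧ ⟪x, n⟫_ℝ < a f.succ}) ≠ ⊤)
    {r : ℝ} (hr : 0 < r) {C : Set E3} (hC : MeasurableSet C)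
    (hsub : ∀ f, ∀ x ∈ E ∩ {x : E3 | a f.castSucc < ⟪x, n⟫_ℝ ∧ ⟪x, n⟫_ℝ < a f.succ},
      ∀ w ∈ {y : E3 | ∀ ν : E3, ⟪y, ν⟫_ℝ ≤ Real.sqrt 2 / 4 *
        ∑ᶠ w ∈ {w | w ∈ fccStacking 1 (Real.sqrt (2 / 3)) ∧ ‖w‖ = 1}, |⟪w, (A f).symm ν⟫_ℝ|},
      x + r • w ∈ C) :
    volume (⋃ f : Fin k, E ∩ {x : E3 | a f.castSucc < ⟪x, n⟫_ℝ ∧ ⟪x, n⟫_ℝ < a f.succ}) ^ ((3 : ℕ)⁻¹ : ℝ) +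
        ENNReal.ofReal r * (ENNReal.ofReal 32) ^ ((3 : ℕ)⁻¹ : ℝ) ≤ volume C ^ ((3 : ℕ)⁻¹ : ℝ) := by
  classical
  set e₂ : E3 := EuclideanSpace.single (2 : Fin 3) (1 : ℝ) with he₂
  set slab : Fin k → Set E3 := fun f => {x : E3 | a f.castSucc < ⟪x, n⟫_ℝ ∧ ⟪x, n⟫_ℝ < a f.succ}
    with hslab
  set E' : Set E3 := ⋃ f : Fin k, E ∩ slab f with hE'
  -- a lamella is occupied; its body is the reference body `B₀`
  obtain ⟨x₀, hx₀⟩ := nonempty_of_measure_ne_zero h0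
  obtain ⟨f₀, -⟩ := mem_iUnion.1 hx₀
  set B₀ : Set E3 := {y : E3 | ∀ ν : E3, ⟪y, ν⟫_ℝ ≤ Real.sqrt 2 / 4 *
    ∑ᶠ w ∈ {w | w ∈ fccStacking 1 (Real.sqrt (2 / 3)) ∧ ‖w‖ = 1}, |⟪w, (A f₀).symm ν⟫_ℝ|} with hB₀
  -- `m` is a unit vector (it is the image of `e₂` under a frame)
  have he : ‖e₂‖ = 1 := by rw [he₂, PiLp.norm_single, norm_one]
  have hm : ‖m‖ = 1 := by
    obtain ⟨L, -, -, -, -, -, -, hLm, -, -⟩ := hAx f₀ f₀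
    rw [← hLm, LinearIsometryEquiv.norm_map, he]
  set Rm : E3 ≃ₗᵢ[ℝ] E3 := (ℝ ∙ m)ᗮ.reflection with hRm
  have hRmn : Rm n = n := reflection_orthogonal_unit_of_inner_eq_zero hm hmn
  -- a frame `L₀` with `L₀ e₂ = n`
  set L₀ : E3 ≃ₗᵢ[ℝ] E3 := (ℝ ∙ (e₂ - n))ᗮ.reflection with hL₀
  have hL₀n : L₀ e₂ = n := Submodule.reflection_sub (by rw [he, hn])
  have hL₀symm : L₀.symm n = e₂ := by rw [← hL₀n, LinearIsometryEquiv.symm_apply_apply]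
  -- the transport `T = coords ∘ L₀⁻¹`
  set meq : E3 ≃ᵐ (Fin 3 → ℝ) := (MeasurableEquiv.toLp 2 (Fin 3 → ℝ)).symm with hmeq
  set T : E3 ≃ᵐ (Fin 3 → ℝ) := L₀.symm.toHomeomorph.toMeasurableEquiv.trans meq with hT
  have hTapply : ∀ x, T x = meq (L₀.symm x) := fun x => rfl
  have hTmp : MeasurePreserving T volume volume :=
    L₀.symm.measurePreserving.trans (EuclideanSpace.volume_preserving_symm_measurableEquiv_toLp (Fin 3))
  have hmeq_mp : MeasurePreserving meq volume volume :=
    EuclideanSpace.volume_preserving_symm_measurableEquiv_toLp (Fin 3)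
  have hTvol : ∀ X : Set E3, MeasurableSet X → volume (T '' X) = volume X := fun X hX => by
    rw [MeasurableEquiv.image_eq_preimage_symm]
    exact hTmp.symm.measure_preimage hX.nullMeasurableSet
  have hT2 : ∀ x : E3, (T x) 2 = ⟪x, n⟫_ℝ := by
    intro x
    rw [hTapply]
    show (L₀.symm x) 2 = ⟪x, n⟫_ℝ
    have h1 : (L₀.symm x) 2 = ⟪L₀.symm x, e₂⟫_ℝ := by
      rw [he₂, EuclideanSpace.inner_single_right]; simp
    rw [h1, ← hL₀symm, LinearIsometryEquiv.inner_map_map]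
  have hTadd : ∀ x y : E3, T (x + y) = T x + T y := fun x y => by
    rw [hTapply, hTapply, hTapply, map_add]; rfl
  have hTimage : ∀ X : Set E3, T '' X = meq '' (L₀.symm '' X) := fun X => by
    rw [← Set.image_comp]; rfl
  -- every body is `B₀` or its mirror image
  have hbody : ∀ f, {y : E3 | ∀ ν : E3, ⟪y, ν⟫_ℝ ≤ Real.sqrt 2 / 4 *
      ∑ᶠ w ∈ {w | w ∈ fccStacking 1 (Real.sqrt (2 / 3)) ∧ ‖w‖ = 1}, |⟪w, (A f).symm ν⟫_ℝ|} = B₀ ∨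
      {y : E3 | ∀ ν : E3, ⟪y, ν⟫_ℝ ≤ Real.sqrt 2 / 4 *
      ∑ᶠ w ∈ {w | w ∈ fccStacking 1 (Real.sqrt (2 / 3)) ∧ ‖w‖ = 1}, |⟪w, (A f).symm ν⟫_ℝ|} = Rm '' B₀ :=
    fun f => cruxWulffBody_eq_or_eq_reflection_image (hAx f₀ f)
  -- the reference body in transported coordinates
  have hB₀c : IsCompact B₀ := isCompact_cruxWulffBody _
  set S : Set E3 := L₀.symm '' (r • B₀) with hSdef
  have hrB₀m : MeasurableSet (r • B₀) := (hB₀c.smul r).isClosed.measurableSet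
  have hS : MeasurableSet S := by
    rw [hSdef, LinearIsometryEquiv.image_eq_preimage_symm]
    exact hrB₀m.preimage L₀.symm.symm.continuous.measurable
  have hrB : -(r • B₀) = r • B₀ := by rw [← Set.smul_set_neg, hB₀, neg_cruxWulffBody_eq]
  have hSsymm : -S = S := by
    ext y
    rw [Set.mem_neg, hSdef, mem_image, mem_image]
    constructor
    · rintro ⟨x, hx, hxy⟩
      refine ⟨-x, ?_, ?_⟩
      · rw [← hrB]; exact Set.neg_mem_neg.2 hx
      · rw [map_neg, hxy, neg_neg]
    · rintro ⟨x, hx, rfl⟩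
      exact ⟨-x, by rw [← hrB]; exact Set.neg_mem_neg.2 hx, by rw [map_neg]⟩
  -- the mirror in transported coordinates fixes the vertical axis
  set N : E3 ≃ₗᵢ[ℝ] E3 := L₀.trans (Rm.trans L₀.symm) with hN
  have hNapply : ∀ x, N x = L₀.symm (Rm (L₀ x)) := fun x => rfl
  have hNe : N e₂ = (1 : ℝ) • e₂ := by rw [hNapply, hL₀n, hRmn, hL₀symm, one_smul]
  -- transported bodies: `meq '' S` or `meq '' (N '' S)`
  have hbodyT : ∀ f, T '' (r • {y : E3 | ∀ ν : E3, ⟪y, ν⟫_ℝ ≤ Real.sqrt 2 / 4 *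
      ∑ᶠ w ∈ {w | w ∈ fccStacking 1 (Real.sqrt (2 / 3)) ∧ ‖w‖ = 1}, |⟪w, (A f).symm ν⟫_ℝ|}) = meq '' S ∨
      T '' (r • {y : E3 | ∀ ν : E3, ⟪y, ν⟫_ℝ ≤ Real.sqrt 2 / 4 *
      ∑ᶠ w ∈ {w | w ∈ fccStacking 1 (Real.sqrt (2 / 3)) ∧ ‖w‖ = 1}, |⟪w, (A f).symm ν⟫_ℝ|}) =
        meq '' (N '' S) := by
    intro f
    rcases hbody f with h | h
    · left
      rw [h, hTimage]
    · right
      rw [h, hTimage]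
      congr 1
      ext z
      simp only [mem_image, hNapply, hSdef]
      constructor
      · rintro ⟨y, hy, rfl⟩
        obtain ⟨y', hy', rfl⟩ := Set.mem_smul_set.1 hy
        obtain ⟨b, hb, rfl⟩ := hy'
        refine ⟨L₀.symm (r • b), ⟨r • b, Set.smul_mem_smul_set hb, rfl⟩, ?_⟩
        rw [LinearIsometryEquiv.apply_symm_apply, map_smul]
      · rintro ⟨_, ⟨y, hy, rfl⟩, rfl⟩
        obtain ⟨b, hb, rfl⟩ := Set.mem_smul_set.1 hy
        refine ⟨r • Rm b, Set.smul_mem_smul_set ⟨b, hb, rfl⟩, ?_⟩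
        simp only [LinearIsometryEquiv.apply_symm_apply, map_smul]
  have hslice_eq : ∀ f u, volume {p : ℝ × ℝ | (![p.1, p.2, u] : Fin 3 → ℝ) ∈
      T '' (r • {y : E3 | ∀ ν : E3, ⟪y, ν⟫_ℝ ≤ Real.sqrt 2 / 4 *
        ∑ᶠ w ∈ {w | w ∈ fccStacking 1 (Real.sqrt (2 / 3)) ∧ ‖w‖ = 1}, |⟪w, (A f).symm ν⟫_ℝ|})} =
      volume {p : ℝ × ℝ | (![p.1, p.2, u] : Fin 3 → ℝ) ∈ meq '' S} := by
    intro f u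
    rcases hbodyT f with h | h
    · rw [h]
    · rw [h]
      exact volume_slice3_image_eq N (Or.inl rfl) hNe hS hSsymm u
  -- the height profile
  set g : ℝ → Fin k := fun t =>
    if h : ∃ f : Fin k, a f.castSucc < t ∧ t < a f.succ then h.choose else f₀ with hg
  have hg_eq : ∀ f t, a f.castSucc < t ∧ t < a f.succ → g t = f := by
    intro f t ht
    have hex : ∃ f : Fin k, a f.castSucc < t ∧ t < a f.succ := ⟨f, ht⟩
    have h1 : g t = hex.choose := by simp only [hg, dif_pos hex]
    rw [h1]
    exact lamella_index_unique ha hex.choose_spec ht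
  -- the chimera inequality in the transported coordinates
  set Wt : ℝ → Set (Fin 3 → ℝ) := fun t => T '' (r • {y : E3 | ∀ ν : E3, ⟪y, ν⟫_ℝ ≤ Real.sqrt 2 / 4 *
    ∑ᶠ w ∈ {w | w ∈ fccStacking 1 (Real.sqrt (2 / 3)) ∧ ‖w‖ = 1}, |⟪w, (A (g t)).symm ν⟫_ℝ|}) with hWt
  set W₀ : Set (Fin 3 → ℝ) := meq '' S with hW₀
  have hslabm : ∀ f, MeasurableSet (slab f) := fun f =>
    (continuous_id.inner continuous_const).measurable (measurableSet_Ioo (a := a f.castSucc) (b := a f.succ))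
  have hE'm : MeasurableSet E' := MeasurableSet.iUnion fun f => hE.inter (hslabm f)
  have hbodym : ∀ f, MeasurableSet (r • {y : E3 | ∀ ν : E3, ⟪y, ν⟫_ℝ ≤ Real.sqrt 2 / 4 *
      ∑ᶠ w ∈ {w | w ∈ fccStacking 1 (Real.sqrt (2 / 3)) ∧ ‖w‖ = 1}, |⟪w, (A f).symm ν⟫_ℝ|}) :=
    fun f => ((isCompact_cruxWulffBody (A f)).smul r).isClosed.measurableSet
  have hvS : volume S = ENNReal.ofReal (r ^ 3) * ENNReal.ofReal 32 := by
    rw [hSdef, LinearIsometryEquiv.image_eq_preimage_symm,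
      L₀.symm.symm.measurePreserving.measure_preimage hrB₀m.nullMeasurableSet,
      Measure.addHaar_smul, finrank_euclideanSpace, Fintype.card_fin, hB₀, volume_cruxWulffBody,
      abs_of_pos (pow_pos hr 3)]
  have hvW₀ : volume W₀ = ENNReal.ofReal (r ^ 3) * ENNReal.ofReal 32 := by
    rw [hW₀, MeasurableEquiv.image_eq_preimage_symm, hmeq_mp.symm.measure_preimage hS.nullMeasurableSet,
      hvS]
  have hchim := Chimera.chimera3_brunnMinkowski (A := T '' E') (C := T '' C) (W₀ := W₀) Wt
    ((MeasurableEquiv.measurableSet_image _).2 hE'm) ((MeasurableEquiv.measurableSet_image _).2 hC)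
    ((MeasurableEquiv.measurableSet_image _).2 hS)
    (fun t => (MeasurableEquiv.measurableSet_image _).2 (hbodym _))
    (fun t u => (hslice_eq (g t) u).symm.le)
    (by
      rintro z ⟨x, hx, rfl⟩ w hw
      obtain ⟨f, hxf⟩ := mem_iUnion.1 hx
      have hgt : g ((T x) 2) = f := hg_eq f _ (by rw [hT2]; exact hxf.2)
      have hw' : w ∈ T '' (r • {y : E3 | ∀ ν : E3, ⟪y, ν⟫_ℝ ≤ Real.sqrt 2 / 4 *
          ∑ᶠ w ∈ {w | w ∈ fccStacking 1 (Real.sqrt (2 / 3)) ∧ ‖w‖ = 1}, |⟪w, (A f).symm ν⟫_ℝ|}) := by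
        rw [← hgt]; exact hw
      obtain ⟨v, hv, rfl⟩ := hw'
      obtain ⟨w', hw'1, rfl⟩ := Set.mem_smul_set.1 hv
      refine ⟨x + r • w', hsub f x hxf w' hw'1, ?_⟩
      rw [hTadd])
    (by rw [hTvol _ hE'm]; exact h0) (by rw [hTvol _ hE'm]; exact htop)
    (by
      rw [hvW₀]
      exact mul_ne_zero (ENNReal.ofReal_pos.2 (by positivity)).ne' (ENNReal.ofReal_pos.2 (by norm_num)).ne')
    (by
      rw [hvW₀]
      exact ENNReal.mul_ne_top ENNReal.ofReal_ne_top ENNReal.ofReal_ne_top)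
  -- read off the volumes
  have hroot : (ENNReal.ofReal (r ^ 3) * ENNReal.ofReal 32) ^ ((3 : ℕ)⁻¹ : ℝ) =
      ENNReal.ofReal r * ENNReal.ofReal 32 ^ ((3 : ℕ)⁻¹ : ℝ) := by
    rw [ENNReal.mul_rpow_of_nonneg _ _ (by positivity), ENNReal.ofReal_rpow_of_nonneg (by positivity)
      (by positivity), Real.pow_rpow_inv_natCast hr.le (by norm_num)]
  rw [hTvol _ hE'm, hTvol _ hC, hvW₀, hroot] at hchim
  exact hchim

end Summit.Ventures.Crystal3D.Theorems

end
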